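import Mathlib
import Summits.KontsevichZagierPeriods.KontsevichZagierPeriods.Theses.InverseLandau
import Literature.NumberTheory.Transcendental.KZLogCalculusProofs
import Summits.KontsevichZagierPeriods.KontsevichZagierPeriods.Theorems.InverseLandauTateLiftingLogSectorAssembly
import Summits.KontsevichZagierPeriods.KontsevichZagierPeriods.Theorems.InverseLandauTateLiftingLogIntegral
import Summits.KontsevichZagierPeriods.KontsevichZagierPeriods.Theorems.InverseLandauTateLiftingBakerDecomposition
import Summits.KontsevichZagierPeriods.KontsevichZagierPeriods.Theorems.InverseLandauTateLiftingTorusFibre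
import Summits.KontsevichZagierPeriods.KontsevichZagierPeriods.Theorems.InverseLandauTateLiftingZsmulRep
import Summits.KontsevichZagierPeriods.KontsevichZagierPeriods.Theorems.LogPrimitiveNL.Negative.DimZero
import Summits.KontsevichZagierPeriods.KontsevichZagierPeriods.Theorems.LogPrimitiveNL.Negative.BakerRelationSpan

/-!
# `TateLifting`, line `Sketch`, stub `stub_affineLogSector` — the affine weight-one sector with `π`

Crux stmt-KontsevichZagierPeriods-9129
(`Summit.KontsevichZagierPeriods.KontsevichZagierPeriods.Theses.InverseLandau.TateLifting`).
The GENERATION statement of the line holds on the subgroup generated by the honest representations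
`rᵢ = [(0,1), aᵢ + γᵢ · 4/(1+z₀²) + βᵢ (αᵢ−1)/(1+(αᵢ−1)z₀)]` of the numbers `aᵢ + γᵢ π + βᵢ log αᵢ`
(`αᵢ > 0`; `aᵢ, γᵢ, βᵢ, αᵢ` real algebraic): every `Σ mᵢ [rᵢ]` with vanishing evaluation lies in
`KZ.relations ⊔ closure 𝒢`.

Proof. (1) Values: `eval [rᵢ] = aᵢ + γᵢ π + βᵢ log αᵢ` (`∫₀¹ 4 dt/(1+t²) = 4 arctan 1 = π`, the
log unfolding `tateLifting_logIntegral`, transport `ℝ¹ → ℝ` by `MeasurableEquiv.funUnique`).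
(2) BAKER, inhomogeneous with `2πi`: from `A + Γπ + Σ cᵢ log αᵢ = 0` (`A = Σ mᵢaᵢ`, `Γ = Σ mᵢγᵢ`,
`cᵢ = mᵢβᵢ`, all real algebraic) first `A = 0` (`baker_sum_eq_zero` with the logarithms
`l = (πi, log α₁, …)`, `e^{πi} = −1`, and coefficients `(−iΓ, c₁, …)`), then the homogeneous relation
is a `ℚ̄`-combination of INTEGER relations (`baker_relation_span_int`), whose imaginary parts force the
`πi`-entries to vanish, whence `Γ = 0`. (3) So `Σ (mᵢβᵢ) log αᵢ = 0` and the logarithmic parts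
`ρᵢ = [(0,1), (mᵢβᵢ)(αᵢ−1)/(1+(αᵢ−1)z₀)]` fall under the landed weight-one sector
(`tateLifting_logSectorAssembly` fed with `tateLifting_bakerDecomposition`, `tateLifting_logIntegral`,
`tateLifting_torusFibre`, `tateLifting_zsmulRep`). (4) Bookkeeping in the free abelian group:
`Σ mᵢ [rᵢ] − Σ [ρᵢ] ∈ KZ.relations`, because `Σ mᵢ (aᵢ + γᵢ q + βᵢ kᵢ) = Σ (mᵢβᵢ) kᵢ` pointwise on the
cube (`A = Γ = 0`), through one total representation (`KZ.of_sub_of_sub_sum_mem_relations`) and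
integer multiples (`tateLifting_zsmulRep`).
-/

noncomputable section

namespace Summit.KontsevichZagierPeriods.InverseLandau

open Literature.NumberTheory.Transcendental
open MeasureTheory
open LogSectorAssembly
open Summit.KontsevichZagierPeriods.LiouvilleUnfolding.LogPrimitiveNL.Negative
  (baker_sum_eq_zero baker_relation_span_int)

/-! ### Values: `∫₀¹ (a + γ · 4/(1+t²) + β (α−1)/(1+(α−1)t)) dt = a + γ π + β log α` -/

/-- `∫₀¹ 4 dt/(1 + t²) = 4 (arctan 1 − arctan 0) = π`. [folklore] -/
theorem affineLogSector_arctan_interval :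
    ∫ t in (0 : ℝ)..1, (4 : ℝ) / (1 + t ^ 2) = Real.pi := by
  have e : (fun t : ℝ => (4 : ℝ) / (1 + t ^ 2)) = fun t => 4 * (1 / (1 + t ^ 2)) := by
    funext t
    ring
  rw [e, intervalIntegral.integral_const_mul, integral_one_div_one_add_sq, Real.arctan_one,
    Real.arctan_zero]
  ring

/-- The affine weight-one integrand over `[0,1]`:
`∫₀¹ (a + γ · 4/(1+t²) + β (α−1)/(1+(α−1)t)) dt = a + γ π + β log α` (`α > 0`). [folklore] -/
theorem affineLogSector_intervalIntegral {α : ℝ} (hα : 0 < α) (a γ β : ℝ) :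
    ∫ t in (0 : ℝ)..1, (a + γ * (4 / (1 + t ^ 2)) + β * ((α - 1) / (1 + (α - 1) * t))) =
      a + γ * Real.pi + β * Real.log α := by
  have hq : IntervalIntegrable (fun t : ℝ => (4 : ℝ) / (1 + t ^ 2)) volume 0 1 :=
    (continuous_const.div (by fun_prop) fun t => by positivity).intervalIntegrable _ _
  have hk : IntervalIntegrable (fun t : ℝ => (α - 1) / (1 + (α - 1) * t)) volume 0 1 :=
    (continuousOn_const.div (by fun_prop) fun t ht =>
      (tateLifting_logIntegral_one_add_mul_pos (c := α - 1) (by linarith)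
        (by rwa [Set.uIcc_of_le zero_le_one])).ne').intervalIntegrable_of_Icc zero_le_one
  have hc : IntervalIntegrable (fun _ : ℝ => a) volume 0 1 := intervalIntegrable_const
  rw [intervalIntegral.integral_add (hc.add (hq.const_mul γ)) (hk.const_mul β),
    intervalIntegral.integral_add hc (hq.const_mul γ), intervalIntegral.integral_const_mul,
    intervalIntegral.integral_const_mul, intervalIntegral.integral_const,
    affineLogSector_arctan_interval]
  have hlog : ∫ t in (0 : ℝ)..1, (α - 1) / (1 + (α - 1) * t) = Real.log α := by
    have h := tateLifting_logIntegral_interval (c := α - 1) (by linarith)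
    rwa [show (1 : ℝ) + (α - 1) = α by ring] at h
  rw [hlog, sub_zero, one_smul]

/-- The affine weight-one integrand over the open unit cube of `ℝ¹`:
`∫_{(0,1)¹} (a + γ · 4/(1+z₀²) + β (α−1)/(1+(α−1)z₀)) dz = a + γ π + β log α` (`α > 0`; transport
`ℝ¹ → ℝ` by `MeasurableEquiv.funUnique`). [folklore] -/
theorem affineLogSector_cubeIntegral {α : ℝ} (hα : 0 < α) (a γ β : ℝ) :
    ∫ z in Set.pi Set.univ (fun _ : Fin 1 => Set.Ioo (0 : ℝ) 1),
        (a + γ * (4 / (1 + z 0 ^ 2)) + β * ((α - 1) / (1 + (α - 1) * z 0))) =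
      a + γ * Real.pi + β * Real.log α := by
  have h := (volume_preserving_funUnique (Fin 1) ℝ).setIntegral_preimage_emb
    (MeasurableEquiv.measurableEmbedding _)
    (fun t : ℝ => a + γ * (4 / (1 + t ^ 2)) + β * ((α - 1) / (1 + (α - 1) * t)))
    (Set.Ioo (0 : ℝ) 1)
  have key := affineLogSector_intervalIntegral hα a γ β
  rw [intervalIntegral.integral_of_le zero_le_one, integral_Ioc_eq_integral_Ioo] at key
  rw [tateLifting_logIntegral_cube_eq_preimage]
  exact h.trans key

/-! ### Baker, inhomogeneous with `2πi`, for real algebraic data -/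

/-- **Baker, inhomogeneous, with `π`**: if `A + Γ π + Σ cᵢ log αᵢ = 0` with `αᵢ > 0` real algebraic
and `A, Γ, cᵢ` real algebraic, then `A = 0` and `Γ = 0`. Complexify with `l = (πi, log α₁, …)`
(`e^{πi} = −1`) and coefficients `(−iΓ, c₁, …)`: the algebraic value `−A` of the linear form vanishes
(`baker_sum_eq_zero`); the homogeneous relation is then a `ℚ̄`-combination of integer relations
(`baker_relation_span_int`), whose imaginary parts kill the `πi`-entries, so `−iΓ = 0`.
[cite: Baker1975, Thm 2.1] -/
theorem affineLogSector_baker {s : ℕ} {α c : Fin s → ℝ} {A Γ : ℝ} (hα : ∀ i, 0 < α i)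
    (hαa : ∀ i, IsAlgebraic ℚ (α i)) (hc : ∀ i, IsAlgebraic ℚ (c i)) (hA : IsAlgebraic ℚ A)
    (hΓ : IsAlgebraic ℚ Γ) (h : A + Γ * Real.pi + ∑ i, c i * Real.log (α i) = 0) :
    A = 0 ∧ Γ = 0 := by
  -- real algebraic numbers are algebraic in `ℂ`
  have ofRealAlg : ∀ {x : ℝ}, IsAlgebraic ℚ x → IsAlgebraic ℚ (x : ℂ) := fun hx =>
    (isAlgebraic_algebraMap_iff (R := ℚ) (A := ℂ) Complex.ofReal_injective).mpr hx
  -- the complex logarithms `l = (πi, log α₁, …, log α_s)`, coefficients `b = (−iΓ, c₁, …, c_s)`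
  obtain ⟨l, hl0, hls⟩ : ∃ l : Fin (s + 1) → ℂ, l 0 = (Real.pi : ℂ) * Complex.I ∧
      ∀ i, l (Fin.succ i) = ((Real.log (α i) : ℝ) : ℂ) :=
    ⟨Fin.cons ((Real.pi : ℂ) * Complex.I) fun i => ((Real.log (α i) : ℝ) : ℂ), by simp,
      fun i => by simp⟩
  obtain ⟨b, hb0, hbs⟩ : ∃ b : Fin (s + 1) → ℂ, b 0 = -(Complex.I * (Γ : ℂ)) ∧
      ∀ i, b (Fin.succ i) = ((c i : ℝ) : ℂ) :=
    ⟨Fin.cons (-(Complex.I * (Γ : ℂ))) fun i => ((c i : ℝ) : ℂ), by simp, fun i => by simp⟩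
  have hI : IsAlgebraic ℚ Complex.I :=
    IsAlgebraic.of_pow two_pos (by rw [Complex.I_sq]; exact isAlgebraic_one.neg)
  have hlalg : ∀ j, IsAlgebraic ℚ (Complex.exp (l j)) := by
    intro j
    refine Fin.cases ?_ (fun i => ?_) j
    · rw [hl0, Complex.exp_pi_mul_I]
      exact isAlgebraic_one.neg
    · rw [hls, ← Complex.ofReal_exp, Real.exp_log (hα i)]
      exact ofRealAlg (hαa i)
  have hbalg : ∀ j, IsAlgebraic ℚ (b j) := by
    intro j
    refine Fin.cases ?_ (fun i => ?_) j
    · rw [hb0]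
      exact (hI.mul (ofRealAlg hΓ)).neg
    · rw [hbs]
      exact ofRealAlg (hc i)
  have hsum : ∑ j, b j * l j = ((-A : ℝ) : ℂ) := by
    rw [Fin.sum_univ_succ, hb0, hl0,
      show -A = Γ * Real.pi + ∑ i, c i * Real.log (α i) by linarith]
    simp only [hbs, hls]
    push_cast
    congr 1
    linear_combination (-(Γ : ℂ) * (Real.pi : ℂ)) * Complex.I_mul_I
  have hA0 : A = 0 := by
    have h0 := baker_sum_eq_zero l b _ hlalg hbalg
      (ofRealAlg hA.neg) hsum
    exact neg_eq_zero.mp (Complex.ofReal_eq_zero.mp h0)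
  refine ⟨hA0, ?_⟩
  have hrel : ∑ j, b j * l j = 0 := by
    rw [hsum, hA0, neg_zero, Complex.ofReal_zero]
  obtain ⟨R, M, β', -, hM, hcoef⟩ := baker_relation_span_int l b hlalg hbalg hrel
  -- imaginary parts: the `πi`-entry of every integer relation vanishes
  have hM0 : ∀ q, M q 0 = 0 := fun q => by
    have him := congrArg Complex.im (hM q)
    rw [Fin.sum_univ_succ, hl0, Complex.add_im, Complex.im_sum, Complex.zero_im] at him
    simp only [hls, Complex.mul_im, Complex.mul_re, Complex.intCast_re, Complex.intCast_im,
      Complex.ofReal_re, Complex.ofReal_im, Complex.I_re, Complex.I_im, mul_zero, zero_mul,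
      mul_one, add_zero, sub_zero, Finset.sum_const_zero] at him
    exact_mod_cast (mul_eq_zero.mp him).resolve_right Real.pi_ne_zero
  have hb00 : b 0 = 0 := by
    rw [hcoef 0]
    simp [hM0]
  rw [hb0, neg_eq_zero, mul_eq_zero, Complex.ofReal_eq_zero] at hb00
  exact hb00.resolve_left Complex.I_ne_zero

/-- Algebraic integer combinations `Σ mᵢ wᵢ` of real algebraic numbers are algebraic. [folklore] -/
theorem affineLogSector_isAlgebraic_sum {s : ℕ} (m : Fin s → ℤ) {w : Fin s → ℝ}
    (hw : ∀ i, IsAlgebraic ℚ (w i)) : IsAlgebraic ℚ (∑ i, (m i : ℝ) * w i) :=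
  Finset.sum_induction _ (fun x => IsAlgebraic ℚ x) (fun _ _ ha hb => ha.add hb)
    isAlgebraic_zero fun i _ => (isAlgebraic_int (m i)).mul (hw i)

/-! ### The honest log representations `[(0,1), μ (α−1)/(1+(α−1)z₀)]` -/

/-- The honest representation `[(0,1)¹, μ (α − 1)/(1 + (α − 1) z₀)]` exists (`α > 0`; `α, μ` real
algebraic). [cite: KontsevichZagier2001, §1.1] -/
theorem affineLogSector_exists_kernelRep {α μ : ℝ} (hα : 0 < α) (hαa : IsAlgebraic ℚ α)
    (hμ : IsAlgebraic ℚ μ) :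
    ∃ ρ : KZ.IntegralRep 1, ρ.domain = Set.pi Set.univ (fun _ : Fin 1 => Set.Ioo (0 : ℝ) 1) ∧
      ρ.integrand = fun z => μ * ((α - 1) / (1 + (α - 1) * z 0)) := by
  obtain ⟨ρ, hd, hi⟩ := exists_combRep (s := 1) (α := fun _ => α) (μ := fun _ => μ) (κ := 1)
    (fun _ => hα) (fun _ => hαa) (fun _ => hμ) isAlgebraic_one
  exact ⟨ρ, hd, by rw [hi]; funext z; simp⟩

/-! ### The affine weight-one sector -/

/-- **Affine weight-one sector of the generation statement, with `π`** (stub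
`stub_affineLogSector` of line `Sketch` for crux `TateLifting`): every vanishing `ℤ`-combination of
honest representations `[(0,1), aᵢ + γᵢ·4/(1+z₀²) + βᵢ(αᵢ−1)/(1+(αᵢ−1)z₀)]` of the numbers
`aᵢ + γᵢπ + βᵢ log αᵢ` (`αᵢ > 0`; `aᵢ, γᵢ, βᵢ, αᵢ` real algebraic) lies in `KZ.relations ⊔ closure 𝒢`.
Baker (inhomogeneous, with `2πi`) forces `Σ mᵢaᵢ = 0` and `Σ mᵢγᵢ = 0`; the logarithmic part is the
landed weight-one sector. [cite: Baker1975, Thm 2.1] -/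
theorem tateLifting_affineLogSector :
    ∀ (s : ℕ) (α β γ a : Fin s → ℝ) (m : Fin s → ℤ) (r : Fin s → KZ.IntegralRep 1),
      (∀ i, 0 < α i) → (∀ i, IsAlgebraic ℚ (α i)) → (∀ i, IsAlgebraic ℚ (β i)) →
      (∀ i, IsAlgebraic ℚ (γ i)) → (∀ i, IsAlgebraic ℚ (a i)) →
      (∀ i, (r i).domain = Set.pi Set.univ (fun _ : Fin 1 => Set.Ioo (0 : ℝ) 1)) →
      (∀ i, Set.EqOn (r i).integrand
        (fun z => a i + γ i * (4 / (1 + z 0 ^ 2)) + β i * ((α i - 1) / (1 + (α i - 1) * z 0)))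
        (r i).domain) →
      KZ.eval (∑ i, m i • KZ.of (r i)) = 0 →
      ∑ i, m i • KZ.of (r i) ∈ KZ.relations ⊔ AddSubgroup.closure
        {d : KZ.FormalRep | ∃ (n k : ℕ) (P Q : MvPolynomial (Fin (n + k)) ℚ) (U : Set (Fin k → ℝ))
            (γ : ℝ → (Fin k → ℝ)) (a : Fin k → ℝ) (r : KZ.IntegralRep n),
          IsOpen U ∧ ContinuousOn γ (Set.Icc 0 1) ∧ γ 0 = 0 ∧ γ 1 = a ∧
          (∀ t ∈ Set.Icc (0 : ℝ) 1, γ t ∈ U) ∧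
          (∃ c₀ : ℚ, c₀ ≠ 0 ∧ ∀ z : Fin n → ℝ,
            MvPolynomial.aeval (Fin.append z (0 : Fin k → ℝ)) Q = (c₀ : ℝ)) ∧
          (∀ (z : Fin n → ℝ) (u : Fin k → ℝ), (∀ i, z i ∈ Set.Icc (0 : ℝ) 1) → u ∈ U →
            MvPolynomial.aeval (Fin.append z u) Q ≠ 0) ∧
          (∀ u ∈ U, ∫ z in Set.pi Set.univ (fun _ : Fin n => Set.Ioo (0 : ℝ) 1),
            MvPolynomial.aeval (Fin.append z u) P / MvPolynomial.aeval (Fin.append z u) Q = 0) ∧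
          (∀ j, IsAlgebraic ℚ (a j)) ∧
          r.domain = Set.pi Set.univ (fun _ : Fin n => Set.Ioo (0 : ℝ) 1) ∧
          Set.EqOn r.integrand (fun z => MvPolynomial.aeval (Fin.append z a) P /
            MvPolynomial.aeval (Fin.append z a) Q) r.domain ∧
          d = KZ.of r} := by
  intro s α β γ a m r hα hαa hβa hγa haa hdom hint hev
  -- (1) values: `eval [rᵢ] = aᵢ + γᵢ π + βᵢ log αᵢ`
  have hval : ∀ i, KZ.eval (KZ.of (r i)) = a i + γ i * Real.pi + β i * Real.log (α i) := by
    intro i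
    rw [KZ.eval_of, KZ.IntegralRep.value, hdom i,
      setIntegral_congr_fun measurableSet_cube (fun z hz => hint i (by rw [hdom i]; exact hz))]
    exact affineLogSector_cubeIntegral (hα i) (a i) (γ i) (β i)
  have h1 : ∑ i, (m i : ℝ) * (a i + γ i * Real.pi + β i * Real.log (α i)) = 0 := by
    simpa only [map_sum, map_zsmul, hval, zsmul_eq_mul] using hev
  have h2 : ∑ i, (m i : ℝ) * a i + (∑ i, (m i : ℝ) * γ i) * Real.pi +
      ∑ i, (m i : ℝ) * β i * Real.log (α i) = 0 := by
    rw [← h1, Finset.sum_mul, ← Finset.sum_add_distrib, ← Finset.sum_add_distrib]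
    exact Finset.sum_congr rfl fun i _ => by ring
  -- (2) Baker, inhomogeneous with `2πi`: the constant and the `π` parts vanish separately
  obtain ⟨hA, hΓ⟩ := affineLogSector_baker (c := fun i => (m i : ℝ) * β i) hα hαa
    (fun i => (isAlgebraic_int (m i)).mul (hβa i)) (affineLogSector_isAlgebraic_sum m haa)
    (affineLogSector_isAlgebraic_sum m hγa) h2
  have hlog : ∑ i, (m i : ℝ) * β i * Real.log (α i) = 0 := by
    rw [hA, hΓ, zero_mul, zero_add, zero_add] at h2
    exact h2
  -- (3) representations: the log parts `ρ i`, integer multiples `R' i`, a total one, a zero one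
  choose ρ hρd hρi using fun i =>
    affineLogSector_exists_kernelRep (hα i) (hαa i) ((isAlgebraic_int (m i)).mul (hβa i))
  choose R' hR'd hR'i using fun i => exists_zsmulRep (m i) (r i)
  have hR' : ∀ i, KZ.of (R' i) - m i • KZ.of (r i) ∈ KZ.relations := fun i =>
    tateLifting_zsmulRep 1 (m i) (r i) (R' i) (hR'd i) fun z _ => by rw [hR'i i]
  obtain ⟨Rtot, hRtd, hRti⟩ := exists_combRep (μ := fun i => (m i : ℝ) * β i) (κ := 1) hα hαa
    (fun i => (isAlgebraic_int (m i)).mul (hβa i)) isAlgebraic_one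
  obtain ⟨R0, hR0d, hR0i⟩ := KZ.exists_zeroRep (n := 1) isSemialgebraic_cube
  have hsum1 : KZ.of Rtot - KZ.of R0 - ∑ i, KZ.of (R' i) ∈ KZ.relations := by
    refine KZ.of_sub_of_sub_sum_mem_relations s Rtot R0 R' (hR0d.trans hRtd.symm)
      (fun i => (hR'd i).trans ((hdom i).trans hRtd.symm)) fun z hz => ?_
    rw [hRtd] at hz
    simp only [hRti, hR0i, hR'i, Pi.zero_apply, zero_add, one_mul]
    calc ∑ i, (m i : ℝ) * β i * ((α i - 1) / (1 + (α i - 1) * z 0))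
        = ∑ i, (m i : ℝ) * a i + (∑ i, (m i : ℝ) * γ i) * (4 / (1 + z 0 ^ 2)) +
            ∑ i, (m i : ℝ) * β i * ((α i - 1) / (1 + (α i - 1) * z 0)) := by
          rw [hA, hΓ]
          ring
      _ = ∑ i, (m i : ℝ) * (a i + γ i * (4 / (1 + z 0 ^ 2)) +
            β i * ((α i - 1) / (1 + (α i - 1) * z 0))) := by
          rw [Finset.sum_mul, ← Finset.sum_add_distrib, ← Finset.sum_add_distrib]
          exact Finset.sum_congr rfl fun i _ => by ring
      _ = ∑ i, (m i : ℝ) * (r i).integrand z :=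
          Finset.sum_congr rfl fun i _ => by rw [hint i (by rw [hdom i]; exact hz)]
  have hsum2 : KZ.of Rtot - KZ.of R0 - ∑ i, KZ.of (ρ i) ∈ KZ.relations := by
    refine KZ.of_sub_of_sub_sum_mem_relations s Rtot R0 ρ (hR0d.trans hRtd.symm)
      (fun i => (hρd i).trans hRtd.symm) fun z _ => ?_
    simp only [hRti, hR0i, hρi, Pi.zero_apply, zero_add, one_mul]
  have h3 : ∑ i, KZ.of (R' i) - ∑ i, KZ.of (ρ i) ∈ KZ.relations := by
    have h := KZ.relations.sub_mem hsum2 hsum1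
    rwa [show KZ.of Rtot - KZ.of R0 - ∑ i, KZ.of (ρ i) -
        (KZ.of Rtot - KZ.of R0 - ∑ i, KZ.of (R' i)) =
      ∑ i, KZ.of (R' i) - ∑ i, KZ.of (ρ i) by abel] at h
  -- (4) the logarithmic parts: the landed weight-one sector
  have hvalρ : ∀ i, KZ.eval (KZ.of (ρ i)) = (m i : ℝ) * β i * Real.log (α i) := fun i => by
    rw [KZ.eval_of, KZ.IntegralRep.value, hρd i]
    simp only [hρi i, integral_const_mul, tateLifting_logIntegral _ (hα i)]
  have hevρ : KZ.eval (∑ i, (1 : ℤ) • KZ.of (ρ i)) = 0 := by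
    simp only [one_zsmul, map_sum, hvalρ]
    exact hlog
  have hW := tateLifting_logSectorAssembly tateLifting_bakerDecomposition tateLifting_logIntegral
    (tateLifting_torusFibre tateLifting_logIntegral) tateLifting_zsmulRep s α
    (fun i => (m i : ℝ) * β i) (fun _ => 1) ρ hα hαa (fun i => (isAlgebraic_int (m i)).mul (hβa i))
    hρd (fun i z _ => by rw [hρi i]) hevρ
  simp only [one_zsmul] at hW
  -- (5) bookkeeping in the free abelian group
  have key : ∑ i, m i • KZ.of (r i) = ∑ i, KZ.of (ρ i) +
      ((∑ i, KZ.of (R' i) - ∑ i, KZ.of (ρ i)) - ∑ i, (KZ.of (R' i) - m i • KZ.of (r i))) := by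
    rw [Finset.sum_sub_distrib]
    abel
  rw [key]
  exact add_mem hW (AddSubgroup.mem_sup_left
    (KZ.relations.sub_mem h3 (KZ.relations.sum_mem fun i _ => hR' i)))

end Summit.KontsevichZagierPeriods.InverseLandau

end
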